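import Literature.NumberTheory.EllipticCurves.Kobayashi2003.SignedSelmer
import Literature.NumberTheory.EllipticCurves.Sprung2017.SharpFlatPAdicLFunction
import HarnessLib

/-!
# Sprung's pairings `P_{n,x}`, Honda systems of local points and the ♯/♭ Coleman map
# `Col = (Col^♯, Col^♭)` with its kernels `Ker Col^♯`, `Ker Col^♭` (definitions; the `η = 1`
# component, written on the dual side `H¹_Iw(T) ≅ Hom(E(ℚ_{p,∞}), ℤ_p)`)

Topic `Literature/NumberTheory/EllipticCurves`, cluster `Sprung2012` (namespace = path). A
DEFINITION file transcribing F. E. I. Sprung, *Iwasawa theory for elliptic curves at supersingular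
primes: A pair of main conjectures*, J. Number Theory **132** (2012) 1483–1506 [Sprung2012]
(held text `paper:doi-10-1016-j-jnt-2011-11-003`; locators `p. NNNN` are journal pages):
Definition 3.1 (the pairings `P_{n,x}`), Theorem 2.2 (Honda's / Kobayashi's system of local points
`(c_n)`, as a predicate), Proposition 5.3 / Definition 5.9 / Proposition 5.7 / Definition 7.1 (the
Coleman map `Col = (Col^♯, Col^♭) = lim← Col_n : H¹_Iw(T) → Λ ⊕ Λ`, as a predicate "`Col(z) =
(L♯, L♭)`", and its kernels "`Ker Col^♯`", "`Ker Col^♭`" entering Definition 7.9) — the FIRST of two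
files (the sequel `Sprung2012/SharpFlatSelmer.lean` transcribes Def. 7.9 / 7.11: the local conditions
`E^{♯/♭}_{∞,𝔭}`, `Sel^{♯/♭}` and the duals `X^{♯/♭}`), in the `η = 1` form of the
introduction (p. 1486: "Let `𝔭` be the prime ideal of `ℚ_∞` above `p`, and
`Sel^♯(E/ℚ_∞) := Ker( Sel(E/ℚ_∞) → E(ℚ_{∞,𝔭}) ⊗ ℚ_p/ℤ_p / E^♯_{∞,𝔭} )`, where the local condition
`E^♯_{∞,𝔭}` is the exact annihilator under the local Tate pairing of `Ker Col^♯`, and similarly define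
`Sel^♭(E/ℚ_∞)`"; "The statements here correspond to the `η = 1` case in the more precise statements
of Section 7"). VOCABULARY ONLY: definitions with bodies and proved unfolding lemmas; NOTHING is
asserted (no named fact in this file). HONEST FRAMING (cell `bsd-ssimc`, seat
`bsd-ssimc-k3c5-kdot-split`, route K3 `SignedLowerHalves`, crux `SprungLowerHalfAtThree` =
stmt-BirchSwinnertonDyer-19003; ledger definition item `defn-SharpFlatSelmerDualData`, BLOCKED
`decl-missing:SharpFlatLocalCondition`): this pair of files supplies the missing local condition; it
proves nothing about any curve and moves no census cell; BSD is not proved by any of this.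

## The transcription convention (the ONE piece of mathematics used to choose the vocabulary)

Sprung's Coleman maps live on `H¹_Iw(T) = lim←_n H¹(k_n, T)` (`T` the `p`-adic Tate module,
`k_n` the local cyclotomic layers) and are built from the pairings of Definition 3.1 (p. 1489):
"`P_{n,x} : H¹(k_n, T) → ℤ_p[G_n]`, `z ↦ ∑_{σ ∈ G_n} (x^σ, z)_n σ` for `x ∈ F_ss(𝔪_n)`, where
`( , )_n : F_ss(𝔪_n) × H¹(k_n, T) → H²(k_n, ℤ_p(1)) ≅ ℤ_p` is the pairing coming from the cup
product. Here, we have put `F_ss(𝔪_n) ⊆ H¹(k_n, T)`" — so `Col(z)` only depends on the FUNCTIONAL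
`x ↦ (x, z)` on local points, and Sprung himself computes with it: "`P⁰_1` is given by
`H¹(k_0, T) → Hom(F_ss(𝔪_0), ℤ_p) ≅ Λ_0`, where the first map comes from the pairing given by the
cup product" (proof of Prop. 7.3, p. 1500). At a SUPERSINGULAR prime this functional IS the class:
Tate local duality at each layer and "`E(K_{n,𝔭_n}) ⊗ ℤ_p` and `E(K_{n,𝔭_n}) ⊗ ℚ_p/ℤ_p` are exact
annihilators of each other, and we have `lim←_n E(K_{n,𝔭_n}) ⊗̂ ℤ_p = 0` since `p` is
supersingular (by [CG] or [Ha])" (Lemma 7.10 and its proof, p. 1503, giving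
`E(K_{∞,𝔭}) ⊗ ℚ_p/ℤ_p = lim→_n H¹(K_{n,𝔭_n}, V/T)`) identify
`H¹_Iw(T) ≅ Hom(E(K_{∞,𝔭}) ⊗ ℚ_p/ℤ_p, ℚ_p/ℤ_p) = Hom_ℤ(E(K_{∞,𝔭}), ℤ_p)` (corestriction ↔
restriction of functionals), with `(x, z)_n = z(x)` and the local Tate pairing of a Kummer class
`x ⊗ p^{-k}` with `z` equal to `z(x)/p^k mod ℤ_p`. ACCORDINGLY this file writes `H¹_Iw(T)` as the
group of additive maps `E(K_∞·K_v) →+ ℤ_p` on the tower points (`localTowerPointsOfEmb`), the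
pairing `P_{n,x}(z)` as the orbit sum `∑_{j<pⁿ} z(γ̃ʲ x)(1+T)ʲ` (`pairingSum`; `G_n ↦ Γ/Γ^{pⁿ}`,
`γ ↦ 1 + T` as in the tree's `Sprung2017.IsSprungPair`), and "`t ∈ E^•_{∞,𝔭}`" for a Kummer class
`t = x ⊗ p^{-k}` as "`z(x) ∈ p^k ℤ_p` for every `z ∈ Ker Col^•`" (`sharpFlatLocalKummerOverOfEmb`,
the shape of `Kobayashi2003.localKummerOverOfEmb`). TODO(general form): `H¹_Iw(T)` with profinite
coefficients and the cup-product pairing themselves (no tree vocabulary); the identification above is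
the supersingular case, which is the paper's standing hypothesis (§2, p. 1486: "`E` is an elliptic
curve over `ℚ` and `p` a prime so that `E` has good supersingular reduction at `p`").

`η = 1` / `ℤ_p`-tower form. Sprung works over `k_n = ℚ_p(ζ_{p^{n+1}})`, `G_n = Δ × Γ_n`,
`Λ = ℤ_p[Δ]⟦X⟧` and takes `η`-components in §7; the introduction states the `η = 1` objects over the
cyclotomic `ℤ_p`-extension `ℚ_∞` (quoted above), which is what the tree's routes consume
(`Λ = IwasawaAlgebra p = ℤ_p⟦T⟧`, `κ : ZpExtension ℚ p` cyclotomic, layers `ℚ_n`). Projecting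
`Λ_n = ℤ_p[Δ × Γ_n] → ℤ_p[Γ_n]` (`δ ↦ 1`) sends `P_{n,c_n}(z)`, for `z` fixed by `Δ`, to the orbit
sum over `Γ_n` of the `Δ`-trace `c'_n = Tr_Δ c_n ∈ Ê(ℚ_{p,n})` (projection formula for the cup
product), and Theorem 2.2's relations `Tr_{n+1/n} c_{n+1} = a_p c_n − c_{n−1}` (`n ≥ 0`),
`Tr_{0/−1} c_0 = (a_p − 2) c_{−1}` become, for the traced system over the layers `ℚ_{p,n}` of the
`ℤ_p`-tower (`ℚ_{p,0} = ℚ_p = k_{−1}`): `c'_0 = (a_p − 2) c_{−1}`,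
`Tr_{1/0} c'_1 = a_p c'_0 − (p − 1) c_{−1}`, `Tr_{n+1/n} c'_{n+1} = a_p c'_n − c'_{n−1}` (`n ≥ 1`)
— this is the form transcribed in `IsHondaSystem` (cf. "[Po1, Theorem 3.1] for the cyclotomic
`ℤ_p`-extension of `ℚ_p` with odd `p`", proof of Thm. 2.2, p. 1487). Odd `p` (Sprung's `N = n + 1`);
TODO(general form): `p = 2` (`N = n + 2`, Thm. 2.2 (2′)).

The Coleman CHARACTERISATION. Definition 5.1 / Prop. 5.3 (p. 1493): `Col_n(z)` is the class in
`(Λ_n ⊕ Λ_n)/Ker h_n` of any `(f♯, f♭)` with `(P¹_n(z), P⁰_n(z)) = (f♯, f♭) 𝓗_n`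
(`P¹_n = P_{n,c_n}`, `P⁰_n = P_{n,c_{n−1}}`, `𝓗_n = Ỹ A_1⋯A_n`, `A_i = (a_p, Φ_i(1+X); −1, 0)`,
`Ỹ = (0, 1; −1, −a_p)`, Notation 3.7 / Def. 3.8 / Prop. 3.9, p. 1491); Def. 5.9 / Prop. 5.7
(p. 1494–1495): `Col = lim← Col_n : H¹_Iw(T) → lim← (Λ_n ⊕ Λ_n)/Ker h_n ≅ Λ ⊕ Λ`, the
isomorphism because `⋂_n M_n = 0` for `M_n = Ker(Λ² → Λ_n² → (Λ_n²)𝓗_n)`; Def. 7.1: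
`Col =: (Col^♯, Col^♭)`. Unfolded: `Col(z) = (L♯, L♭)` iff for every `n`,
`(L♯, L♭)·𝓗_n ≡ (P_{n,c_n}(z_n), P_{n,c_{n−1}}(z_n)) (mod ω_n)`. Since `𝓗_n = 𝓗_{n−1} A_n`, the
first column of `𝓗_n` satisfies `x_n = a_p x_{n−1} − Φ_{pⁿ⁻¹… }` — precisely
`col₁(𝓗_n) = −(u_n, v_n)ᵀ` with `u_n = Sprung2017.sharpPoly`, `v_n = Sprung2017.flatPoly`
(`𝓗_0 = Ỹ`: `(0, −1)`; `𝓗_1 = (−1, 0; 0, −Φ_1)`: `(−1, 0)`; then the three-term recursion) — and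
`col₂(𝓗_n) = Φ_{pⁿ}(1+X)·col₁(𝓗_{n−1})`, while `P_{n,x} = Φ_{pⁿ}(1+X)·P_{n−1,x}` for `x` of level
`n − 1`, so the second-column congruence at level `n` is the first-column congruence at level
`n − 1`. Hence the transcription `IsColemanPair`: **`ω_n ∣ P_{n,c_n}(z) + u_n L♯ + v_n L♭` for all
`n`** — symbol for symbol the tree's `Sprung2017.IsSprungPair` (`θ_n ≡ −(u_n L♯ + v_n L♭) (mod ω_n)`)
with the Mazur–Tate element `θ_n` replaced by `P_{n,c_n}(z)` (as it must: `L^{♯/♭}_p = ` the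
`η`-component of `Col^{♯/♭}` of Kato's zeta element, Def. 6.1, and `θ_n` is the image of Kato's
element under `P_{n,c_n}`, Prop. 6.3–6.5; Sprung chose `Ỹ` "to match a sign convention of
Kobayashi", Def. 3.8 and footnote 4). Existence of `Col(z)` for every `z` (Props. 3.9, 5.3, 5.5,
5.6) and uniqueness (Prop. 5.7) are NOT asserted here (they are the content of the sibling fact
file); the definitions below quantify over candidate values.

## Contents (all `def`s have bodies; lemmas are unfolding API)

* `localTowerPointsOfEmb κ ι W = E(K_∞·K_v)` (points of `W` over `K̄_v` fixed by
  `Gal(K̄_v/K_∞·K_v) = localSubgroupOfEmb κ.kerSubgroup ι`), containing every layer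
  `Kobayashi2003.localLayerPointsOfEmb κ ι W n` and stable under `Γ_{K_v}`;
* `evalOn A z` (a functional `z : A →+ ℤ_p` on a subgroup of local points, extended by `0`),
  `pairingSum A g n x z = ∑_{j<pⁿ} z(gʲ•x)(1+T)ʲ ∈ Λ` (Def. 3.1 under the convention);
* `IsHondaSystem κ ι W ap g cneg c` (Thm. 2.2, `ℤ_p`-tower form: levels, the trace relations,
  and the GENERATION clause "`F_ss(𝔪_n)` is generated by `c_n` and `c_{n−1}` as a
  `ℤ_p[G_n]`-module" in its dual form on functionals — see its docstring);
* `IsColemanPair κ ι W ap g c z L♯ L♭` (Def. 5.9 / 7.1 unfolded, above);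
  `colemanKer κ ι W ap g c •` = the functionals `z` with `Col^•(z) = 0` ("`Ker Col^♯`",
  "`Ker Col^♭`" of Def. 7.9).
The sequel `Sprung2012/SharpFlatSelmer.lean` builds on `colemanKer` the local conditions
`E^•_{∞,𝔭}` (Def. 7.9), `Sel^•(E/K_∞)` and `X^•(E/K_∞)` (Def. 7.11). Intended instance: `K = ℚ`,
`κ` cyclotomic, `K_v = ℚ_p`, `ap = a_p(E)`, `g ∈ Γ_{ℚ_p}` restricting to the normalised topological
generator `γ` (`κ.IsTopGenerator γ`, `IsCyclotomicVariable p γ`, as for `IsSprungPair`), `(cneg, c)` a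
Honda system. Not here (facts for sibling files): Thm. 2.2 itself (existence of Honda systems),
Props. 3.9/5.3–5.7 (every `z` has exactly one Coleman value), Prop. 7.3/7.6 (images of `Col^♯`,
`Col^♭`). Open Problem 7.22 (p. 1505: no explicit trace-map description of `E^{♯/♭}_{∞,𝔭}` is
known) is the reason the ♯/♭ local condition must be phrased through `Ker Col^•`.

## References
* [Sprung2012] F. E. I. Sprung, J. Number Theory 132 (2012) 1483–1506: §1 p. 1486; Thm. 2.2,
  Lemma 2.3, Def. 2.4 (pp. 1487–1488); Def. 3.1, Prop. 3.3, Notation 3.7, Def. 3.8, Prop. 3.9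
  (pp. 1489–1491); Def. 5.1, Prop. 5.3, Lemma 5.4, Cor. 5.6, Prop. 5.7, Def. 5.9 (pp. 1493–1495);
  Def. 6.1; Def. 7.1/7.2, Prop. 7.3, Def. 7.9, Lemma 7.10, Def. 7.11, Thm. 7.14, Thm. 7.16,
  Prop. 7.19, Main Conj. 7.21, Open Problem 7.22 (pp. 1500–1505).
* [Kobayashi2003] S. Kobayashi, Invent. Math. 152 (2003), Def. 1.1, §8 (Prop. 8.12, Lemma 8.15,
  (8.23)) — the `a_p = 0` case (`Col^♯ = Col^−`, `Col^♭ = Col^+`, Sprung p. 1485).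
* [Sprung2017] F. Sprung, ANT 11 (2017), Cor. 4.4 (the recursion `u_n`, `v_n`).
* [CoatesGreenberg1996] J. Coates, R. Greenberg, Invent. Math. 124 (1996) (universal norms).
-/

noncomputable section

open scoped Classical

open NumberField IsDedekindDomain Polynomial

universe u

namespace Literature.NumberTheory.EllipticCurves.Sprung2012

open Literature.NumberTheory.EllipticCurves Literature.NumberTheory.GaloisRepresentations ZpExtension
  Literature.NumberTheory.EllipticCurves.Kobayashi2003 Literature.NumberTheory.EllipticCurves.Sprung2017

/-! ### The local tower points `E(K_∞·K_v)` and functionals on them -/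

section Local

variable {K : Type u} [Field K] {p : ℕ} [Fact p.Prime] (κ : ZpExtension K p)
variable {E : Type u} [Field E] [Algebra K E] (ι : AlgebraicClosure K →ₐ[K] AlgebraicClosure E)
variable (W : WeierstrassCurve K)

/-- **`E(K_∞·K_v)`** — the points of `W` over `K̄_v` (`localPoints W E`, `E = K_v`) fixed by
`Gal(K̄_v / K_∞·K_v) = localSubgroupOfEmb κ.kerSubgroup ι` (the preimage of `Gal(K̄/K_∞) = ker κ`
under the restriction attached to `ι`): Sprung's `E(K_{∞,𝔭})` / `E(ℚ_{∞,𝔭})` (p. 1486, Lemma 7.10),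
the union of the layers `E(K_n·K_v) = Kobayashi2003.localLayerPointsOfEmb κ ι W n`
(`localLayerPointsOfEmb_le_localTowerPointsOfEmb`). Under the convention of the module docstring,
`H¹_Iw(T)` is the group of additive maps `E(K_∞·K_v) →+ ℤ_p`.
[cite: Sprung2012, §1 p. 1486 and Lemma 7.10 (p. 1503)] -/
def localTowerPointsOfEmb : AddSubgroup (localPoints W E) :=
  FixedPoints.addSubgroup (localSubgroupOfEmb κ.kerSubgroup ι) (localPoints W E)

/-- Membership in `E(K_∞·K_v)`: fixed by every `τ ∈ Gal(K̄_v/K_∞·K_v)`.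
[cite: Sprung2012, §1 p. 1486 (unfolding)] -/
theorem mem_localTowerPointsOfEmb_iff (P : localPoints W E) :
    P ∈ localTowerPointsOfEmb κ ι W ↔
      ∀ τ : Field.absoluteGaloisGroup E, τ ∈ localSubgroupOfEmb κ.kerSubgroup ι → τ • P = P := by
  rw [localTowerPointsOfEmb, FixedPoints.mem_addSubgroup, Subtype.forall]
  rfl

/-- Every layer `E(K_n·K_v)` lies in `E(K_∞·K_v)` (`ker κ ≤ κ⁻¹(pⁿℤ_p)`).
[cite: Sprung2012, Lemma 7.10 (p. 1503) (`E(K_{∞,𝔭}) = ⋃_n E(K_{n,𝔭_n})`)] -/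
theorem localLayerPointsOfEmb_le_localTowerPointsOfEmb (n : ℕ) :
    localLayerPointsOfEmb κ ι W n ≤ localTowerPointsOfEmb κ ι W := by
  intro P hP
  rw [mem_localTowerPointsOfEmb_iff]
  intro τ hτ
  refine (mem_localLayerPointsOfEmb_iff κ ι W n P).1 hP τ ?_
  rw [mem_localSubgroupOfEmb_iff] at hτ ⊢
  exact κ.kerSubgroup_le_layerSubgroup n hτ

/-- `E(K_∞·K_v)` is stable under `Γ_{K_v}` (`Gal(K̄_v/K_∞·K_v)` is normal in `Γ_{K_v}`, being
the preimage of the normal subgroup `ker κ`) — the `Γ_{K_v}`-action through which the orbit sums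
`P_{n,x}` are formed. [cite: Sprung2012, Def. 3.1 (p. 1489) (the `G_n`-orbit `x^σ`; unfolding API)] -/
theorem smul_mem_localTowerPointsOfEmb (g : Field.absoluteGaloisGroup E) {P : localPoints W E}
    (hP : P ∈ localTowerPointsOfEmb κ ι W) : g • P ∈ localTowerPointsOfEmb κ ι W := by
  rw [mem_localTowerPointsOfEmb_iff] at hP ⊢
  intro τ hτ
  have hconj : g⁻¹ * τ * g ∈ localSubgroupOfEmb κ.kerSubgroup ι := by
    rw [mem_localSubgroupOfEmb_iff] at hτ ⊢
    rw [map_mul, map_mul, map_inv]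
    exact κ.kerSubgroup_normal.conj_mem' _ hτ _
  have h := hP _ hconj
  calc τ • g • P = (g * (g⁻¹ * τ * g)) • P := by rw [← mul_smul]; congr 1; group
    _ = g • P := by rw [mul_smul, h]

/-- A functional `z : A →+ ℤ_p` on a subgroup `A` of local points, read as a function on all of
`E(K̄_v)` by `0` off `A` (bookkeeping device for orbit sums; on `A` it is `z`). [folklore] -/
def evalOn (A : AddSubgroup (localPoints W E)) (z : A →+ ℤ_[p]) (P : localPoints W E) : ℤ_[p] :=
  if h : P ∈ A then z ⟨P, h⟩ else 0

/-- On `A`, `evalOn A z` is `z` (unfolding API of the transcription of Def. 3.1).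
[cite: Sprung2012, Def. 3.1 (p. 1489) (unfolding)] -/
@[simp] theorem evalOn_of_mem (A : AddSubgroup (localPoints W E)) (z : A →+ ℤ_[p])
    {P : localPoints W E} (hP : P ∈ A) : evalOn W A z P = z ⟨P, hP⟩ := by
  rw [evalOn, dif_pos hP]

/-- Off `A`, `evalOn A z` is `0` (junk value; unfolding API of the transcription of Def. 3.1).
[cite: Sprung2012, Def. 3.1 (p. 1489) (unfolding)] -/
theorem evalOn_of_not_mem (A : AddSubgroup (localPoints W E)) (z : A →+ ℤ_[p])
    {P : localPoints W E} (hP : P ∉ A) : evalOn W A z P = 0 := by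
  rw [evalOn, dif_neg hP]

/-- **Sprung's pairing `P_{n,x}(z)`** (Definition 3.1: "`P_{n,x} : H¹(k_n, T) → ℤ_p[G_n]`,
`z ↦ ∑_{σ∈G_n} (x^σ, z)_n σ`"), under the convention of the module docstring (`(x^σ, z)_n = z(σx)`,
`G_n ↦ Γ/Γ^{pⁿ} = {γ̃ʲ : j < pⁿ}`, `γ̃ʲ ↦ (1+T)ʲ`): for a local Galois element `g` (meant: one
restricting to the chosen topological generator `γ` of `Gal(K_∞/K)`), a point `x` (meant: of level
`n`, `x ∈ E(K_n·K_v)`, so that the orbit `{gʲ x : j < pⁿ}` is the `Γ_n`-orbit) and a functional `z`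
on `A` (meant: `A = E(K_∞·K_v)` or a layer), the element `∑_{j<pⁿ} z(gʲ•x)·(1+T)ʲ ∈ Λ = ℤ_p⟦T⟧`,
a representative of `P_{n,x}(z) ∈ Λ_n = Λ/ω_n`. [cite: Sprung2012, Def. 3.1 (p. 1489)] -/
def pairingSum (A : AddSubgroup (localPoints W E)) (g : Field.absoluteGaloisGroup E) (n : ℕ)
    (x : localPoints W E) (z : A →+ ℤ_[p]) : IwasawaAlgebra p :=
  ∑ j ∈ Finset.range (p ^ n),
    PowerSeries.C (evalOn W A z (g ^ j • x)) * (1 + PowerSeries.X) ^ j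

/-- Unfolding `pairingSum`. [cite: Sprung2012, Def. 3.1 (p. 1489) (unfolding)] -/
theorem pairingSum_def (A : AddSubgroup (localPoints W E)) (g : Field.absoluteGaloisGroup E) (n : ℕ)
    (x : localPoints W E) (z : A →+ ℤ_[p]) :
    pairingSum W A g n x z = ∑ j ∈ Finset.range (p ^ n),
      PowerSeries.C (evalOn W A z (g ^ j • x)) * (1 + PowerSeries.X) ^ j :=
  rfl

/-- `P_{n,x}` is additive in the functional. [cite: Sprung2012, Def. 3.1 (p. 1489) ("By linearity")] -/
theorem pairingSum_add (A : AddSubgroup (localPoints W E)) (g : Field.absoluteGaloisGroup E) (n : ℕ)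
    (x : localPoints W E) (z z' : A →+ ℤ_[p]) :
    pairingSum W A g n x (z + z') = pairingSum W A g n x z + pairingSum W A g n x z' := by
  rw [pairingSum, pairingSum, pairingSum, ← Finset.sum_add_distrib]
  refine Finset.sum_congr rfl fun j _ => ?_
  by_cases h : g ^ j • x ∈ A
  · rw [evalOn_of_mem W A _ h, evalOn_of_mem W A _ h, evalOn_of_mem W A _ h, AddMonoidHom.add_apply,
      map_add, add_mul]
  · rw [evalOn_of_not_mem W A _ h, evalOn_of_not_mem W A _ h, evalOn_of_not_mem W A _ h, map_zero,
      zero_mul, zero_add]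

/-- `P_{n,x}(0) = 0`. [cite: Sprung2012, Def. 3.1 (p. 1489) ("By linearity")] -/
@[simp] theorem pairingSum_zero (A : AddSubgroup (localPoints W E)) (g : Field.absoluteGaloisGroup E)
    (n : ℕ) (x : localPoints W E) : pairingSum W A g n x (0 : A →+ ℤ_[p]) = 0 := by
  rw [pairingSum]
  refine Finset.sum_eq_zero fun j _ => ?_
  by_cases h : g ^ j • x ∈ A
  · rw [evalOn_of_mem W A _ h, AddMonoidHom.zero_apply, map_zero, zero_mul]
  · rw [evalOn_of_not_mem W A _ h, map_zero, zero_mul]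

/-! ### Honda systems (Theorem 2.2) and the Coleman characterisation (Def. 5.9 / 7.1) -/

/-- **A Honda system of local points** — the output of Sprung's Theorem 2.2 (p. 1487: "There exist
`c_n ∈ F_ss(𝔪_n) ≅ Ê(𝔪_n)` so that as a `ℤ_p[G_n]`-module, `F_ss(𝔪_n)` is generated by `c_n` and
`c_{n−1}` when `n ⩾ 0`. `F_ss(𝔪_{−1})` is generated by `c_{−1}` when `p` is odd … They satisfy the
relations: (1) `Tr_{n+1/n} c_{n+1} = a_p c_n − c_{n−1}` if `n ⩾ 0`, (2) `Tr_{0/−1} c_0 = (a_p − 2)c_{−1}`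
when `p` is odd"; "essentially [Kobayashi, Proposition 8.12] and [Kobayashi, Lemma 8.9]. See also
… [Po1, Theorem 3.1] for the cyclotomic `ℤ_p`-extension of `ℚ_p` with odd `p`"), in the
`ℤ_p`-tower form of the module docstring (`c n` = the `Δ`-trace `c'_n ∈ E(K_n·K_v)` of Sprung's
`c_n`, `cneg = c_{−1} ∈ E(K_v)`, `ap = a_p`, `g` a local lift of the generator, traces
`Tr_{n/m} = Kobayashi2003.localTraceOfEmb κ ι W m n`): (levels) `cneg ∈ E(K_0·K_v)`,
`c n ∈ E(K_n·K_v)`; (relations, odd `p`) `c 0 = (a_p − 2)•cneg`, `Tr_{1/0}(c 1) = a_p•(c 0) −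
(p − 1)•cneg`, `Tr_{n+1/n}(c (n+1)) = a_p•(c n) − c (n−1)` for `n ≥ 1`; (generation, DUAL FORM —
at a supersingular prime `Ê(𝔪_n)` is a free `ℤ_p`-module, `E(k_n)/Ê(𝔪_n) ≅ Ẽ(𝔽_p)` has order prime
to `p`, so `Hom_ℤ(E(k_n), ℤ_p) = Hom_{ℤ_p}(Ê(𝔪_n), ℤ_p)` and "`c_n`, `c_{n−1}` generate `Ê(𝔪_n)` over
`ℤ_p[G_n]`", i.e. `ℤ_p[G_n]² ↠ Ê(𝔪_n)`, is equivalent to: the dual map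
`z ↦ (P_{n,c_n}(z), P_{n,c_{n−1}}(z))`, `Hom_ℤ(E(k_n), ℤ_p) → Λ_n²`, is injective with
`p`-torsion-free cokernel): for `n ≥ 1`, a functional `z` on `E(K_n·K_v)` with
`P_{n,c n}(z) ≡ P_{n,c (n−1)}(z) ≡ 0 (mod ω_n)` is `0`, and a pair `(a, b) ∈ Λ²` with
`p·(a, b) ≡ (P_{n,c n}(z), P_{n,c(n−1)}(z))` for some `z` is itself `≡ (P_{n,c n}(y), P_{n,c(n−1)}(y))`
for some `y`; at level `0` ("`F_ss(𝔪_{−1})` is generated by `c_{−1}`"): `z ↦ z(cneg)` is injective on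
functionals of `E(K_v)` with `p`-saturated image. TODO(verbatim form): the primal generation clause
once formal-group points `Ê(𝔪_n)` are tree vocabulary; TODO(general form): `p = 2`.
A predicate; nothing asserted (existence is Thm. 2.2, a fact for a sibling file).
[cite: Sprung2012, Thm. 2.2 (p. 1487), Cor. 2.10 (p. 1489), Lemmas 7.4–7.5 (p. 1500)] -/
def IsHondaSystem (ap : ℤ) (g : Field.absoluteGaloisGroup E) (cneg : localPoints W E)
    (c : ℕ → localPoints W E) : Prop :=
  -- levels
  cneg ∈ localLayerPointsOfEmb κ ι W 0 ∧ (∀ n, c n ∈ localLayerPointsOfEmb κ ι W n) ∧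
  -- the trace relations (odd `p`, `ℤ_p`-tower form)
  c 0 = (ap - 2) • cneg ∧
  localTraceOfEmb κ ι W 0 1 (c 1) = ap • c 0 - ((p : ℤ) - 1) • cneg ∧
  (∀ n, 1 ≤ n → localTraceOfEmb κ ι W n (n + 1) (c (n + 1)) = ap • c n - c (n - 1)) ∧
  -- generation, level `0` (dual form): evaluation at `c_{−1}` is injective with `p`-saturated image
  (∀ z : localLayerPointsOfEmb κ ι W 0 →+ ℤ_[p], evalOn W _ z cneg = 0 → z = 0) ∧
  (∀ (a : ℤ_[p]), (∃ z : localLayerPointsOfEmb κ ι W 0 →+ ℤ_[p], evalOn W _ z cneg = p * a) →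
    ∃ y : localLayerPointsOfEmb κ ι W 0 →+ ℤ_[p], evalOn W _ y cneg = a) ∧
  -- generation, level `n ≥ 1` (dual form)
  (∀ n, 1 ≤ n → ∀ z : localLayerPointsOfEmb κ ι W n →+ ℤ_[p],
    toIwasawa p (cyclotomicOmega p n) ∣ pairingSum W _ g n (c n) z →
    toIwasawa p (cyclotomicOmega p n) ∣ pairingSum W _ g n (c (n - 1)) z → z = 0) ∧
  (∀ n, 1 ≤ n → ∀ (a b : IwasawaAlgebra p),
    (∃ z : localLayerPointsOfEmb κ ι W n →+ ℤ_[p],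
      toIwasawa p (cyclotomicOmega p n) ∣ PowerSeries.C (p : ℤ_[p]) * a - pairingSum W _ g n (c n) z ∧
      toIwasawa p (cyclotomicOmega p n) ∣
        PowerSeries.C (p : ℤ_[p]) * b - pairingSum W _ g n (c (n - 1)) z) →
    ∃ y : localLayerPointsOfEmb κ ι W n →+ ℤ_[p],
      toIwasawa p (cyclotomicOmega p n) ∣ a - pairingSum W _ g n (c n) y ∧
      toIwasawa p (cyclotomicOmega p n) ∣ b - pairingSum W _ g n (c (n - 1)) y)

/-- **`Col(z) = (L♯, L♭)`** — Sprung's Coleman map `Col = (Col^♯, Col^♭) = lim← Col_n : H¹_Iw(T) →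
Λ ⊕ Λ` (Def. 5.1, Prop. 5.3, Cor. 5.6, Prop. 5.7, Def. 5.9, Def. 7.1) UNFOLDED as a predicate on a
functional `z` on `E(K_∞·K_v)` and a candidate value `(L♯, L♭) ∈ Λ²` (module docstring, "The Coleman
CHARACTERISATION"): for every `n ≥ 0`,
`P_{n,c_n}(z) ≡ −(u_n·L♯ + v_n·L♭) (mod ω_n)`, i.e. `ω_n ∣ P_{n,c n}(z) + u_n L♯ + v_n L♭` in `Λ`,
with `u_n = Sprung2017.sharpPoly ap p n`, `v_n = Sprung2017.flatPoly ap p n` (`= −col₁(𝓗_n)`),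
`ω_n = cyclotomicOmega p n`. Levels `0`, `1` read `L♭ ≡ −z(c_0) (mod T)`, `L♯ ≡ −P_{1,c_1}(z)
(mod ω_1)` (Def. 7.2: `Col_0 = (−a_p P¹_0 + P⁰_0, −P¹_0)`, `Col^♭_1 = −P¹_1`). A predicate; that
every `z` has exactly one Coleman value (Props. 3.9, 5.3, 5.7) is NOT asserted here.
[cite: Sprung2012, Def. 5.1, Prop. 5.3, Prop. 5.7 and Def. 5.9 (pp. 1493–1495), Def. 7.1–7.2 (p. 1500), Notation 3.7–Prop. 3.9 (p. 1491)] -/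
def IsColemanPair (ap : ℤ) (g : Field.absoluteGaloisGroup E) (c : ℕ → localPoints W E)
    (z : localTowerPointsOfEmb κ ι W →+ ℤ_[p]) (Lsharp Lflat : IwasawaAlgebra p) : Prop :=
  ∀ n : ℕ, toIwasawa p (cyclotomicOmega p n) ∣
    pairingSum W (localTowerPointsOfEmb κ ι W) g n (c n) z +
      (toIwasawa p (sharpPoly ap p n) * Lsharp + toIwasawa p (flatPoly ap p n) * Lflat)

/-- Unfolding `IsColemanPair`. [cite: Sprung2012, Def. 5.9 (p. 1495) (unfolding)] -/
theorem isColemanPair_iff (ap : ℤ) (g : Field.absoluteGaloisGroup E) (c : ℕ → localPoints W E)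
    (z : localTowerPointsOfEmb κ ι W →+ ℤ_[p]) (Lsharp Lflat : IwasawaAlgebra p) :
    IsColemanPair κ ι W ap g c z Lsharp Lflat ↔
      ∀ n : ℕ, toIwasawa p (cyclotomicOmega p n) ∣
        pairingSum W (localTowerPointsOfEmb κ ι W) g n (c n) z +
          (toIwasawa p (sharpPoly ap p n) * Lsharp + toIwasawa p (flatPoly ap p n) * Lflat) :=
  Iff.rfl

/-- The zero functional has Coleman value `(0, 0)`. [cite: Sprung2012, Def. 5.9 (p. 1495) (unfolding)] -/
theorem isColemanPair_zero (ap : ℤ) (g : Field.absoluteGaloisGroup E) (c : ℕ → localPoints W E) :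
    IsColemanPair κ ι W ap g c 0 0 0 := by
  intro n
  simp

/-- **`Ker Col^•`** (`• ∈ {♯, ♭}`): the functionals `z` on `E(K_∞·K_v)` (`= H¹_Iw(T)` under the
convention) having a Coleman value `(L♯, L♭)` whose `•`-component `Sprung2017.chromaticL • L♯ L♭`
vanishes — "`Ker Col^♯`" / "`Ker Col^♭`" of Def. 7.9. [cite: Sprung2012, Def. 7.1 and Def. 7.9 (pp. 1500, 1503)] -/
def colemanKer (ap : ℤ) (g : Field.absoluteGaloisGroup E) (c : ℕ → localPoints W E) (col : Chroma) :
    Set (localTowerPointsOfEmb κ ι W →+ ℤ_[p]) :=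
  {z | ∃ Lsharp Lflat : IwasawaAlgebra p,
    IsColemanPair κ ι W ap g c z Lsharp Lflat ∧ chromaticL col Lsharp Lflat = 0}

/-- Membership in `Ker Col^•`. [cite: Sprung2012, Def. 7.9 (p. 1503) (unfolding)] -/
theorem mem_colemanKer_iff (ap : ℤ) (g : Field.absoluteGaloisGroup E) (c : ℕ → localPoints W E)
    (col : Chroma) (z : localTowerPointsOfEmb κ ι W →+ ℤ_[p]) :
    z ∈ colemanKer κ ι W ap g c col ↔ ∃ Lsharp Lflat : IwasawaAlgebra p,
      IsColemanPair κ ι W ap g c z Lsharp Lflat ∧ chromaticL col Lsharp Lflat = 0 :=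
  Iff.rfl

/-- `0 ∈ Ker Col^•`. [cite: Sprung2012, Def. 7.9 (p. 1503) (unfolding)] -/
theorem zero_mem_colemanKer (ap : ℤ) (g : Field.absoluteGaloisGroup E) (c : ℕ → localPoints W E)
    (col : Chroma) : (0 : localTowerPointsOfEmb κ ι W →+ ℤ_[p]) ∈ colemanKer κ ι W ap g c col :=
  ⟨0, 0, isColemanPair_zero κ ι W ap g c, by cases col <;> rfl⟩

end Local

end Literature.NumberTheory.EllipticCurves.Sprung2012

end
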